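import Summits.ResolutionOfSingularities.ResolutionOfSingularities.Theorems.FrobeniusLadderFInjectiveMacaulayficationTauFloorP2d5CXChartNotFull
import Summits.ResolutionOfSingularities.ResolutionOfSingularities.Theorems.FrobeniusLadderFInjectiveMacaulayficationTauFloorP2d5CYChartBadFibre
import Summits.ResolutionOfSingularities.ResolutionOfSingularities.Theorems.FrobeniusLadderFInjectiveMacaulayficationTauFloorP2d5CInput
import HarnessLib

/-!
# THE WHOLE CLOSED FIBRE OF THE P2d5C τ-FLOOR IS NON-FULL, and the non-FULL locus of floor 1 is EXACTLY the closed fibre (dimension 4)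
# (crux `FInjectiveMacaulayfication` stmt-ResolutionOfSingularities-15315, chain w45a; (O-1″), the ∀-strengthening of this seat's p642216 `tauFloor_P2d5C_not_full`
# (∃-form); kernel form of res-L1-w45a-idea-1's FB5-r5 §3.3 «floor-1 bad locus of dim 4 = the exceptional divisor itself»; chartwise Fedder check by
# res-L1-w45a-tri-2 g16 (#651); seat res-L1-w45a-stub-1 g11)

[OURS · L1 W4.5a] Support file (`--supports stmt-ResolutionOfSingularities-15315 --as helper`); replaces the role of NO printed item; NOT a statement of any
manuscript; def-free; UNCONDITIONAL; `CharP k 2`. AI-written (AI review is weaker than expert review).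

`X = Spec A₀`, `A₀ = k[X0..X5]/(f)`, `f = X5² + X0⁴X5 + X1³ + X2³ + X3³ + X4³`, `v` the vertex, `τ = Ideal.span {x̄², ȳ, ū, t̄, s̄, z̄}`, `I = τ̃|_{Spec 𝒪_{X,v}}`.
* §1 `not_fullCl_reesChart_tau_over` — every prime over `v` of each of the six Rees charts is NON-FULL (`D(x̄²)`: `TauFloorP2d5CXChartNotFull` §4; `D(ȳ)`, `D(ū)`,
  `D(t̄)`, `D(s̄)`: `TauFloorP2d5CYChartBadFibre` §2–§3; `D(z̄)`: no such prime, `TauFloorP2d5CZChart`), ★ `not_fullCl_stalk_affineBlowup_tau_over` — every stalk of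
  `Bl_τ X` over `v` is NON-FULL (`LocalBlowupBadFibreFromCharts`);
* §2 ★★★ `tauFloor_P2d5C_closedFibre_not_full` — for EVERY blowing up `g : S′ → Spec 𝒪_{X,v}` along `I`, EVERY point of `S′` over the closed point has a NON-FULL
  local ring; ★★★ `tauFloor_P2d5C_not_fullCl_iff` — the non-FULL locus of `S′` is EXACTLY the closed fibre (off it `S′` is regular by p642216's
  `tauFloor_P2d5C_input_legal` (3), and regular ⇒ FULL, `FTemkinClosedPoints.fullCl_of_isRegularLocalRing`). So on floor 1 of the first d = 5 row the reduced
  non-FULL locus = the reduced singular locus = the reduced exceptional fibre, of dimension 4.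
[folklore assembly; cite: GortzWedhorn2020, (13.19), Prop. 13.91 (2)] [cite: StacksProject, Tag 0804; Tag 02OS] [cite: Fedder1983, Prop. 1.7 (context)]
-/

-- single-problem summit: the doubled namespace component is forced
set_option linter.dupNamespace false

noncomputable section

namespace Summit.ResolutionOfSingularities.ResolutionOfSingularities.Theorems.FInjectiveMacaulayfication.TauFloorP2d5CBadFibre

open CategoryTheory CategoryTheory.Limits AlgebraicGeometry TopologicalSpace IsLocalRing MvPolynomial
open Literature.AlgebraicGeometry.Resolution
open Summit.ResolutionOfSingularities.ResolutionOfSingularities.Theorems.FInjectiveMacaulayfication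
open SliceableCentre GermOfGlobalBlowup

/-! ## §1 Every stalk of `Bl_τ X` over the vertex is NON-FULL -/

set_option maxHeartbeats 800000 in
-- six chart cases, each one transport
/-- Every prime CONTRACTING TO `v` of each of the six Rees charts of `Bl_τ X` (`a ∈ {x̄², ȳ, ū, t̄, s̄, z̄}`) has a NON-FULL local ring. [OURS · assembly of chart certificates] -/
theorem not_fullCl_reesChart_tau_over (k : Type) [Field k] [CharP k 2] (f : MvPolynomial (Fin 6) k) (hf : f = X 5 ^ 2 + X 0 ^ 4 * X 5 + X 1 ^ 3 + X 2 ^ 3 + X 3 ^ 3 + X 4 ^ 3)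
    (v : Spec (.of (MvPolynomial (Fin 6) k ⧸ Ideal.span {f})))
    (hv : v.asIdeal = Ideal.span (Set.range fun j : Fin 6 => Ideal.Quotient.mk (Ideal.span {f}) (X j)))
    (a : MvPolynomial (Fin 6) k ⧸ Ideal.span {f}) (ha : a ∈ (Ideal.span {Ideal.Quotient.mk (Ideal.span {f}) (X 0) ^ 2, Ideal.Quotient.mk (Ideal.span {f}) (X 1), Ideal.Quotient.mk (Ideal.span {f}) (X 2), Ideal.Quotient.mk (Ideal.span {f}) (X 3), Ideal.Quotient.mk (Ideal.span {f}) (X 4), Ideal.Quotient.mk (Ideal.span {f}) (X 5)} : Ideal (MvPolynomial (Fin 6) k ⧸ Ideal.span {f})))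
    (h : a = Ideal.Quotient.mk (Ideal.span {f}) (X 0) ^ 2 ∨ a = Ideal.Quotient.mk (Ideal.span {f}) (X 1) ∨ a = Ideal.Quotient.mk (Ideal.span {f}) (X 2) ∨ a = Ideal.Quotient.mk (Ideal.span {f}) (X 3) ∨ a = Ideal.Quotient.mk (Ideal.span {f}) (X 4) ∨ a = Ideal.Quotient.mk (Ideal.span {f}) (X 5))
    (q : PrimeSpectrum (HomogeneousLocalization.Away (reesGrading (Ideal.span {Ideal.Quotient.mk (Ideal.span {f}) (X 0) ^ 2, Ideal.Quotient.mk (Ideal.span {f}) (X 1), Ideal.Quotient.mk (Ideal.span {f}) (X 2), Ideal.Quotient.mk (Ideal.span {f}) (X 3), Ideal.Quotient.mk (Ideal.span {f}) (X 4), Ideal.Quotient.mk (Ideal.span {f}) (X 5)} : Ideal (MvPolynomial (Fin 6) k ⧸ Ideal.span {f}))) (reesT a ha)))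
    (hq : PrimeSpectrum.comap (reesChartBase a ha) q = v) : ¬ FullCl 2 (Localization.AtPrime q.asIdeal) := by
  rcases h with rfl | rfl | rfl | rfl | rfl | rfl
  · exact LocalBlowupBadFibreFromCharts.not_fullCl_reesChart_over_of_blowupAlgebra _ _ ha 2 v
      (fun Q _ hQv => TauFloorP2d5CXChartNotFull.not_fullCl_localization_blowupAlgebra_over k f hf v hv Q hQv) q hq
  · exact LocalBlowupBadFibreFromCharts.not_fullCl_reesChart_over_of_blowupAlgebra _ _ ha 2 v
      (fun Q _ hQv => TauFloorP2d5CYChartBadFibre.not_fullCl_localization_blowupAlgebra_over k f hf v hv Q hQv) q hq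
  · exact LocalBlowupBadFibreFromCharts.not_fullCl_reesChart_over_of_blowupAlgebra _ _ ha 2 v
      (fun Q _ hQv => TauFloorP2d5CYChartBadFibre.not_fullCl_localization_blowupAlgebra_over_of_swap k f hf v hv 2 (Or.inl rfl) Q hQv) q hq
  · exact LocalBlowupBadFibreFromCharts.not_fullCl_reesChart_over_of_blowupAlgebra _ _ ha 2 v
      (fun Q _ hQv => TauFloorP2d5CYChartBadFibre.not_fullCl_localization_blowupAlgebra_over_of_swap k f hf v hv 3 (Or.inr (Or.inl rfl)) Q hQv) q hq
  · exact LocalBlowupBadFibreFromCharts.not_fullCl_reesChart_over_of_blowupAlgebra _ _ ha 2 v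
      (fun Q _ hQv => TauFloorP2d5CYChartBadFibre.not_fullCl_localization_blowupAlgebra_over_of_swap k f hf v hv 4 (Or.inr (Or.inr rfl)) Q hQv) q hq
  · exact absurd hq (LocalBlowupInputFromCharts.not_comap_eq_of_map_eq_top _ _ ha v (TauFloorP2d5CZChart.map_vertex_eq_top k f hf v hv) q)

set_option maxHeartbeats 800000 in
-- the `Set.range`-presentation transport
/-- ★ **Every stalk of `Bl_τ X = affineBlowup τ` over the vertex is NON-FULL.** [OURS · assembly; cite: StacksProject, Tag 0804] -/
theorem not_fullCl_stalk_affineBlowup_tau_over (k : Type) [Field k] [CharP k 2] (f : MvPolynomial (Fin 6) k) (hf : f = X 5 ^ 2 + X 0 ^ 4 * X 5 + X 1 ^ 3 + X 2 ^ 3 + X 3 ^ 3 + X 4 ^ 3)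
    (v : Spec (.of (MvPolynomial (Fin 6) k ⧸ Ideal.span {f})))
    (hv : v.asIdeal = Ideal.span (Set.range fun j : Fin 6 => Ideal.Quotient.mk (Ideal.span {f}) (X j)))
    (y : ↥(affineBlowup (Ideal.span {Ideal.Quotient.mk (Ideal.span {f}) (X 0) ^ 2, Ideal.Quotient.mk (Ideal.span {f}) (X 1), Ideal.Quotient.mk (Ideal.span {f}) (X 2), Ideal.Quotient.mk (Ideal.span {f}) (X 3), Ideal.Quotient.mk (Ideal.span {f}) (X 4), Ideal.Quotient.mk (Ideal.span {f}) (X 5)} : Ideal (MvPolynomial (Fin 6) k ⧸ Ideal.span {f}))))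
    (hy : (affineBlowup.π (Ideal.span {Ideal.Quotient.mk (Ideal.span {f}) (X 0) ^ 2, Ideal.Quotient.mk (Ideal.span {f}) (X 1), Ideal.Quotient.mk (Ideal.span {f}) (X 2), Ideal.Quotient.mk (Ideal.span {f}) (X 3), Ideal.Quotient.mk (Ideal.span {f}) (X 4), Ideal.Quotient.mk (Ideal.span {f}) (X 5)} : Ideal (MvPolynomial (Fin 6) k ⧸ Ideal.span {f}))).base y = v) :
    ¬ FullCl 2 ((affineBlowup (Ideal.span {Ideal.Quotient.mk (Ideal.span {f}) (X 0) ^ 2, Ideal.Quotient.mk (Ideal.span {f}) (X 1), Ideal.Quotient.mk (Ideal.span {f}) (X 2), Ideal.Quotient.mk (Ideal.span {f}) (X 3), Ideal.Quotient.mk (Ideal.span {f}) (X 4), Ideal.Quotient.mk (Ideal.span {f}) (X 5)} : Ideal (MvPolynomial (Fin 6) k ⧸ Ideal.span {f}))).presheaf.stalk y) := by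
  have key : ∀ (J : Ideal (MvPolynomial (Fin 6) k ⧸ Ideal.span {f})), J = (Ideal.span {Ideal.Quotient.mk (Ideal.span {f}) (X 0) ^ 2, Ideal.Quotient.mk (Ideal.span {f}) (X 1), Ideal.Quotient.mk (Ideal.span {f}) (X 2), Ideal.Quotient.mk (Ideal.span {f}) (X 3), Ideal.Quotient.mk (Ideal.span {f}) (X 4), Ideal.Quotient.mk (Ideal.span {f}) (X 5)} : Ideal (MvPolynomial (Fin 6) k ⧸ Ideal.span {f})) →
      ∀ (i : Fin 6) (hi : (![Ideal.Quotient.mk (Ideal.span {f}) (X 0) ^ 2, Ideal.Quotient.mk (Ideal.span {f}) (X 1), Ideal.Quotient.mk (Ideal.span {f}) (X 2), Ideal.Quotient.mk (Ideal.span {f}) (X 3), Ideal.Quotient.mk (Ideal.span {f}) (X 4), Ideal.Quotient.mk (Ideal.span {f}) (X 5)] : Fin 6 → MvPolynomial (Fin 6) k ⧸ Ideal.span {f}) i ∈ J)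
        (q : PrimeSpectrum (HomogeneousLocalization.Away (reesGrading J) (reesT _ hi))), PrimeSpectrum.comap (reesChartBase _ hi) q = v →
        ¬ FullCl 2 (Localization.AtPrime q.asIdeal) := by
    rintro J rfl i hi q hq
    refine not_fullCl_reesChart_tau_over k f hf v hv _ hi ?_ q hq
    fin_cases i
    exacts [Or.inl rfl, Or.inr (Or.inl rfl), Or.inr (Or.inr (Or.inl rfl)), Or.inr (Or.inr (Or.inr (Or.inl rfl))), Or.inr (Or.inr (Or.inr (Or.inr (Or.inl rfl)))),
      Or.inr (Or.inr (Or.inr (Or.inr (Or.inr rfl))))]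
  have h := LocalBlowupBadFibreFromCharts.not_fullCl_stalk_affineBlowup_of_charts_over 2 (![Ideal.Quotient.mk (Ideal.span {f}) (X 0) ^ 2, Ideal.Quotient.mk (Ideal.span {f}) (X 1), Ideal.Quotient.mk (Ideal.span {f}) (X 2), Ideal.Quotient.mk (Ideal.span {f}) (X 3), Ideal.Quotient.mk (Ideal.span {f}) (X 4), Ideal.Quotient.mk (Ideal.span {f}) (X 5)] : Fin 6 → MvPolynomial (Fin 6) k ⧸ Ideal.span {f}) v
    (fun i _ q hq => key _ (TauFloorP2d5CInput.span_range_eq_tau k f) i _ q hq)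
  rw [TauFloorP2d5CInput.span_range_eq_tau k f] at h
  exact h y hy

/-! ## §2 ★★★ The whole closed fibre of the τ-floor is NON-FULL; the non-FULL locus is exactly the closed fibre -/

/-- ★★★ **THE WHOLE CLOSED FIBRE OF THE P2d5C τ-FLOOR IS NON-FULL.** For every blowing up `g : S′ → Spec 𝒪_{X,v}` along `I = τ̃|_{Spec 𝒪_{X,v}}`, EVERY point
`s ∈ S′` over the closed point has a NON-FULL local ring (the reduced closed fibre is 4-dimensional: idea-1's «floor-1 bad locus of dim 4 = the exceptional
divisor itself»). [OURS · assembly; cite: GortzWedhorn2020, Prop. 13.91 (2)] [cite: Fedder1983, Prop. 1.7 (context)] -/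
theorem tauFloor_P2d5C_closedFibre_not_full (k : Type) [Field k] [CharP k 2] (f : MvPolynomial (Fin 6) k) (hf : f = X 5 ^ 2 + X 0 ^ 4 * X 5 + X 1 ^ 3 + X 2 ^ 3 + X 3 ^ 3 + X 4 ^ 3)
    (v : Spec (.of (MvPolynomial (Fin 6) k ⧸ Ideal.span {f})))
    (hv : v.asIdeal = Ideal.span (Set.range fun j : Fin 6 => Ideal.Quotient.mk (Ideal.span {f}) (X j)))
    (S' : Scheme.{0}) (g : S' ⟶ Spec ((Spec (.of (MvPolynomial (Fin 6) k ⧸ Ideal.span {f}))).presheaf.stalk v))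
    (hg : IsBlowup g ((affineBlowup.idealSheaf
        (Ideal.span {Ideal.Quotient.mk (Ideal.span {f}) (X 0) ^ 2, Ideal.Quotient.mk (Ideal.span {f}) (X 1), Ideal.Quotient.mk (Ideal.span {f}) (X 2), Ideal.Quotient.mk (Ideal.span {f}) (X 3), Ideal.Quotient.mk (Ideal.span {f}) (X 4), Ideal.Quotient.mk (Ideal.span {f}) (X 5)})).comap
        ((Spec (.of (MvPolynomial (Fin 6) k ⧸ Ideal.span {f}))).fromSpecStalk v))) :
    ∀ s : S', g.base s = closedPoint ((Spec (.of (MvPolynomial (Fin 6) k ⧸ Ideal.span {f}))).presheaf.stalk v) → ¬ FullCl 2 (S'.presheaf.stalk s) :=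
  LocalBlowupBadFibreFromCharts.not_fullCl_over_closedPoint_of_isBlowup_comap_fromSpecStalk 2 v (affineBlowup.isBlowup _)
    (not_fullCl_stalk_affineBlowup_tau_over k f hf v hv) hg

/-- ★★★ **THE NON-FULL LOCUS OF THE P2d5C τ-FLOOR IS EXACTLY THE CLOSED FIBRE.** For every blowing up `g : S′ → Spec 𝒪_{X,v}` along `I` and every `s ∈ S′`:
`¬ FullCl 2 𝒪_{S′,s} ↔ g s =` the closed point (`→`: off the closed fibre `S′` is regular, p642216's `tauFloor_P2d5C_input_legal` (3), and regular local rings of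
characteristic `2` are FULL; `←`: `tauFloor_P2d5C_closedFibre_not_full`). [OURS · assembly] -/
theorem tauFloor_P2d5C_not_fullCl_iff (k : Type) [Field k] [CharP k 2] (f : MvPolynomial (Fin 6) k) (hf : f = X 5 ^ 2 + X 0 ^ 4 * X 5 + X 1 ^ 3 + X 2 ^ 3 + X 3 ^ 3 + X 4 ^ 3)
    (v : Spec (.of (MvPolynomial (Fin 6) k ⧸ Ideal.span {f})))
    (hv : v.asIdeal = Ideal.span (Set.range fun j : Fin 6 => Ideal.Quotient.mk (Ideal.span {f}) (X j)))
    (S' : Scheme.{0}) (g : S' ⟶ Spec ((Spec (.of (MvPolynomial (Fin 6) k ⧸ Ideal.span {f}))).presheaf.stalk v))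
    (hg : IsBlowup g ((affineBlowup.idealSheaf
        (Ideal.span {Ideal.Quotient.mk (Ideal.span {f}) (X 0) ^ 2, Ideal.Quotient.mk (Ideal.span {f}) (X 1), Ideal.Quotient.mk (Ideal.span {f}) (X 2), Ideal.Quotient.mk (Ideal.span {f}) (X 3), Ideal.Quotient.mk (Ideal.span {f}) (X 4), Ideal.Quotient.mk (Ideal.span {f}) (X 5)})).comap
        ((Spec (.of (MvPolynomial (Fin 6) k ⧸ Ideal.span {f}))).fromSpecStalk v)))
    (s : S') : ¬ FullCl 2 (S'.presheaf.stalk s) ↔ g.base s = closedPoint ((Spec (.of (MvPolynomial (Fin 6) k ⧸ Ideal.span {f}))).presheaf.stalk v) := by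
  haveI : Fact (Nat.Prime 2) := ⟨Nat.prime_two⟩
  refine ⟨fun hbad => ?_, fun hs => tauFloor_P2d5C_closedFibre_not_full k f hf v hv S' g hg s hs⟩
  by_contra hne
  have hreg := (TauFloorP2d5CInput.tauFloor_P2d5C_input_legal k f hf v hv S' g hg).2.2.1 s hne
  rw [Scheme.mem_regularLocus] at hreg
  haveI := hreg
  -- `S′ → Spec 𝒪_{X,v} → X → Spec k` gives the characteristic of the stalk
  haveI : CharP (S'.presheaf.stalk s) 2 :=
    FTemkinClosedPoints.charP_stalk_of_over 2
      ((Spec (.of (MvPolynomial (Fin 6) k ⧸ Ideal.span {f}))).fromSpecStalk v ≫ Spec.map (CommRingCat.ofHom (algebraMap k (MvPolynomial (Fin 6) k ⧸ Ideal.span {f})))) g s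
  exact hbad (FTemkinClosedPoints.fullCl_of_isRegularLocalRing 2 _)

end Summit.ResolutionOfSingularities.ResolutionOfSingularities.Theorems.FInjectiveMacaulayfication.TauFloorP2d5CBadFibre

end
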